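import Literature.MathematicalPhysics.QuantumLattice.KomaPiFluxKLSInequality
import Literature.MathematicalPhysics.QuantumLattice.GibbsVariationalPrinciple
import HarnessLib

/-!
# The nearest-neighbour `η` correlation from the energy (Koma 2022, Appendix B, (B.1)–(B.11))

T. Koma, *Nambu–Goldstone modes for superconducting lattice fermions*, arXiv:2201.13135 (2022)
[Koma2022], Appendix B proves the lower bound (6.36), `E₁ ≥ ½ - δ̃(β)/(dg) - |κ|/g`, for the
nearest-neighbour `η` correlation `E₁` by reading it off the mean energy: (B.1)
`⟨H_int⟩ = g Σ_{|x-y|=1}⟨Γ¹_xΓ¹_y⟩` (rotation symmetry), (B.2) `⟨H_hop⟩ ≥ -d|κ||Λ|`, hence (B.3)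
`-d|κ| ≤ E_β + dg E₁`, and then the thermodynamic estimate (B.7)–(B.11) `E_β ≤ E₀ + δ̃(β)` with the
variational bound (B.17)–(B.18) `E₀ ≤ -dg/2`.

This file PROVES the finite-volume versions of (B.1)–(B.11) in the Lieb frame of this series, for the
tree's Hamiltonian `H₀ = K(T_π) + UΣ(n-½)(n-½) + H_pair(g,0)` (Koma's model is `U = -2(d+1)g`, cf.
`KomaPiFluxPrintedModel.lean`):

* `PairHopRP.bondTerm_zero_eq`, `KomaPiFlux.pairInteraction_zero_eq` — the operator identity
  `H_pair(g,0) = g(d+1) Σ_x P_x - (g/4) Σ_{x∼y} (Γ¹_xΓ¹_y + Γ²_xΓ²_y)`, `P_x = (Γ¹_x)²` ((3.4)–(3.5));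
* `KomaPiFlux.re_gibbsState_hamiltonian_eq` — (B.1) in the form
  `Re⟨H₀⟩_β = Re⟨K⟩_β + (U/2 + g(d+1)) Σ_x Re⟨P_x⟩_β - U|Λ|/4 - g N₁`, `N₁ = Σ_iΣ_x Re⟨Γ¹_xΓ¹_{x+e_i}⟩_β`;
* `KomaPiFlux.re_gibbsState_hopping_ge` — (B.2): `Re⟨K(T_π)⟩_β ≥ -4(d+1)κ|Λ|`;
* `KomaPiFlux.re_gibbsState_hamiltonian_le_groundEnergy_add` — (B.7)–(B.10) in finite volume:
  `Re⟨H₀⟩_β ≤ E₀(H₀) + |Λ| log 4/β` (entropy `≤ log dim = |Λ| log 4`);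
* `KomaPiFlux.nearestNeighbour_lower_bound` — (B.3)+(B.11):
  `g N₁ ≥ -E₀(H₀) - |Λ| log 4/β - 4(d+1)κ|Λ| - U|Λ|/4 - {-(U/2 + g(d+1))}₊ |Λ|`.
  (The variational input (B.17), `E₀(H₀) ≤ U|Λ|/4 + g(d+1)|Λ|/2`, is the sequel.)

No named fact.

## References

* [Koma2022] T. Koma, arXiv:2201.13135, (3.4)–(3.7), (6.32), (6.36), Appendix B (B.1)–(B.11).
* [Ruelle1969] D. Ruelle, *Statistical Mechanics* (1969), §2.5–2.6 (energy–entropy inequalities).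
-/

noncomputable section

namespace Literature.MathematicalPhysics.QuantumLattice

open Matrix Finset HubbardWave0 PairHopRP FermionTorus LiebCutRP
open Literature.Probability.LatticeModels
open scoped ComplexOrder

namespace PairHopRP

variable {Λ : Type*} [LinearOrder Λ] [Fintype Λ]

/-- The bond term at field `0` in `η`-spin form:
`(g/8){[Γ¹_x-Γ¹_y]² + [Γ²_x-Γ²_y]²} = (g/4)(P_x + P_y) - (g/4)(Γ¹_xΓ¹_y + Γ²_xΓ²_y)`, `P = (Γ¹)² = (Γ²)²`
(the `Γ`'s at different sites commute). [cite: Koma2022, (3.4)–(3.5)] -/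
theorem bondTerm_zero_eq (x y : Λ) (g : ℝ) :
    bondTerm g 0 x y = ((g / 4 : ℝ) : ℂ) • (gammaOne x * gammaOne x + gammaOne y * gammaOne y) -
      ((g / 4 : ℝ) : ℂ) • (gammaOne x * gammaOne y + gammaTwo x * gammaTwo y) := by
  rw [bondTerm, Complex.ofReal_zero, zero_smul, add_zero]
  rw [Matrix.sub_mul, Matrix.mul_sub, Matrix.mul_sub, Matrix.sub_mul, Matrix.mul_sub, Matrix.mul_sub, gammaOne_comm y x,
    gammaTwo_comm y x, ← gammaOne_sq_eq_gammaTwo_sq x, ← gammaOne_sq_eq_gammaTwo_sq y,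
    show ((g / 4 : ℝ) : ℂ) = (2 : ℂ) * ((g / 8 : ℝ) : ℂ) by push_cast; ring, mul_smul, mul_smul]
  module

end PairHopRP

namespace KomaPiFlux

attribute [local instance] LiebCutRP.decEqTorus

variable {d L : ℕ} [NeZero L]

/-! ### (3.4)–(3.5): the pair interaction in `η`-spin form -/

/-- `Σ_{x∼y ordered} (P_x + P_y) = 4(d+1) Σ_x P_x` on the torus (`2(d+1)` neighbours). [cite: Koma2022, (3.4)–(3.5)] -/
theorem sum_adj_onSite_add (h3 : 3 ≤ L) (P : FermionTorus (d + 1) L → Matrix (Finset (Orb (FermionTorus (d + 1) L)))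
    (Finset (Orb (FermionTorus (d + 1) L))) ℂ) :
    ∑ x : FermionTorus (d + 1) L, ∑ y : FermionTorus (d + 1) L, (if (G d L).Adj x y then P x + P y else 0) =
      (4 * (d + 1) : ℕ) • ∑ x : FermionTorus (d + 1) L, P x := by
  rw [← sum_shift_add_sum_shift_swap h3 (fun x y => P x + P y)]
  have hshift : ∀ μ : Fin (d + 1), ∑ x : FermionTorus (d + 1) L, P (shift x μ) = ∑ x : FermionTorus (d + 1) L, P x := by
    intro μ
    have e := Equiv.sum_comp (shiftEquiv (L := L) μ) P
    simp only [shiftEquiv_apply] at e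
    exact e
  calc ∑ x : FermionTorus (d + 1) L, ∑ μ : Fin (d + 1), (P x + P (shift x μ) + (P (shift x μ) + P x))
      = ∑ μ : Fin (d + 1), ∑ x : FermionTorus (d + 1) L, (2 • P x + 2 • P (shift x μ)) := by
        rw [Finset.sum_comm]
        refine Finset.sum_congr rfl fun μ _ => Finset.sum_congr rfl fun x _ => ?_
        rw [two_smul, two_smul]; abel
    _ = ∑ _μ : Fin (d + 1), (4 : ℕ) • ∑ x : FermionTorus (d + 1) L, P x := by
        refine Finset.sum_congr rfl fun μ _ => ?_
        rw [Finset.sum_add_distrib, ← Finset.smul_sum, ← Finset.smul_sum, hshift μ, ← add_smul]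
    _ = (4 * (d + 1) : ℕ) • ∑ x : FermionTorus (d + 1) L, P x := by
        rw [Finset.sum_const, Finset.card_univ, Fintype.card_fin, smul_smul, mul_comm]

/-- **`H_pair(g,0) = g(d+1) Σ_x P_x - (g/4) Σ_{x∼y} (Γ¹_xΓ¹_y + Γ²_xΓ²_y)`** (ordered adjacent pairs;
`P_x = (Γ¹_x)²`). [cite: Koma2022, (3.4)–(3.5)] -/
theorem pairInteraction_zero_eq (h3 : 3 ≤ L) (g : ℝ) :
    PairHopRP.pairInteraction (G d L) g (fun (_ _ : FermionTorus (d + 1) L) => (0 : ℝ)) =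
      ((g * (d + 1 : ℕ) : ℝ) : ℂ) • ∑ x : FermionTorus (d + 1) L, gammaOne x * gammaOne x -
        ((g / 4 : ℝ) : ℂ) • ∑ x : FermionTorus (d + 1) L, ∑ y : FermionTorus (d + 1) L,
          (if (G d L).Adj x y then gammaOne x * gammaOne y + gammaTwo x * gammaTwo y else 0) := by
  unfold PairHopRP.pairInteraction
  have hpt : ∀ x y : FermionTorus (d + 1) L, (if (G d L).Adj x y then bondTerm g 0 x y else 0) =
      ((g / 4 : ℝ) : ℂ) • (if (G d L).Adj x y then gammaOne x * gammaOne x + gammaOne y * gammaOne y else 0) -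
        ((g / 4 : ℝ) : ℂ) • (if (G d L).Adj x y then gammaOne x * gammaOne y + gammaTwo x * gammaTwo y else 0) := by
    intro x y
    split_ifs
    · exact bondTerm_zero_eq x y g
    · simp
  simp_rw [hpt, Finset.sum_sub_distrib, ← Finset.smul_sum]
  rw [sum_adj_onSite_add h3, ← Nat.cast_smul_eq_nsmul ℂ, smul_smul]
  congr 2
  push_cast
  ring

/-! ### (B.1): the mean energy in terms of `N₁` -/

/-- The on-site interaction in `η`-spin form: `Σ_x (n_{x↑}-½)(n_{x↓}-½) = ½ Σ_x P_x - |Λ|/4`.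
[cite: Koma2022, (3.7)] -/
theorem sum_hubbardU_eq {Λ : Type*} [LinearOrder Λ] [Fintype Λ] :
    ∑ x : Λ, (numberOp x 0 - (1 / 2 : ℂ) • 1) * (numberOp x 1 - (1 / 2 : ℂ) • 1) =
      (1 / 2 : ℂ) • ∑ x : Λ, gammaOne x * gammaOne x -
        ((Fintype.card Λ : ℂ) / 4) • (1 : Matrix (Finset (Orb Λ)) (Finset (Orb Λ)) ℂ) := by
  have h : ∀ x : Λ, (numberOp x 0 - (1 / 2 : ℂ) • 1) * (numberOp x 1 - (1 / 2 : ℂ) • 1) =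
      (1 / 2 : ℂ) • (gammaOne x * gammaOne x) - (1 / 4 : ℂ) • (1 : Matrix (Finset (Orb Λ)) (Finset (Orb Λ)) ℂ) := by
    intro x
    rw [gammaOne_mul_self_eq' x]
    module
  simp_rw [h]
  rw [Finset.sum_sub_distrib, ← Finset.smul_sum, Finset.sum_const, Finset.card_univ, ← Nat.cast_smul_eq_nsmul ℂ, smul_smul]
  congr 2
  ring

/-- **(B.1), finite volume**: for `H₀ = H(κ,U,g,0,0)` and its own Gibbs state,
`Re⟨H₀⟩ = Re⟨K(T_π)⟩ + (U/2 + g(d+1)) Σ_x Re⟨P_x⟩ - U|Λ|/4 - g N₁` with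
`N₁ = Σ_i Σ_x Re⟨Γ¹_xΓ¹_{x+e_i}⟩` (the `Γ²Γ²` correlations equal the `Γ¹Γ¹` ones by the rotation
symmetry (6.31)). [cite: Koma2022, App. B (B.1)] -/
theorem re_gibbsState_hamiltonian_eq (h3 : 3 ≤ L) (β κ U g : ℝ) :
    (gibbsState β (hamiltonian κ U g (fun (_ _ : FermionTorus (d + 1) L) => (0 : ℝ)) 0)
        (hamiltonian κ U g (fun (_ _ : FermionTorus (d + 1) L) => (0 : ℝ)) 0)).re =
      (gibbsState β (hamiltonian κ U g (fun (_ _ : FermionTorus (d + 1) L) => (0 : ℝ)) 0)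
          (peierlsHubbard (G d L) (piFluxAmpl κ) 0)).re +
        (U / 2 + g * (d + 1)) * ∑ x : FermionTorus (d + 1) L,
          (gibbsState β (hamiltonian κ U g (fun (_ _ : FermionTorus (d + 1) L) => (0 : ℝ)) 0) (gammaOne x * gammaOne x)).re -
        U * (L : ℝ) ^ (d + 1) / 4 -
        g * ∑ i : Fin (d + 1), ∑ x : FermionTorus (d + 1) L,
          pairCorr β (hamiltonian κ U g (fun (_ _ : FermionTorus (d + 1) L) => (0 : ℝ)) 0) x (shift x i) := by
  set H₀ := hamiltonian κ U g (fun (_ _ : FermionTorus (d + 1) L) => (0 : ℝ)) 0 with hH₀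
  have hH : H₀.IsHermitian := hamiltonian_isHermitian (G d L) (piFluxAmpl κ) (piFluxAmpl_herm κ) U g _ 0
  have hZ : partitionFn β H₀ ≠ 0 := (partitionFn_pos β hH).ne'
  -- the `Γ¹Γ¹` and `Γ²Γ²` nearest-neighbour sums
  have h11 : ∑ x : FermionTorus (d + 1) L, ∑ y : FermionTorus (d + 1) L,
      (if (G d L).Adj x y then (gibbsState β H₀ (gammaOne x * gammaOne y)).re else 0) =
      2 * ∑ i : Fin (d + 1), ∑ x : FermionTorus (d + 1) L, pairCorr β H₀ x (shift x i) := by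
    have hsymm : ∀ x y : FermionTorus (d + 1) L, pairCorr β H₀ y x = pairCorr β H₀ x y := fun x y => pairCorr_symm β H₀ y x
    rw [← sum_shift_add_sum_shift_swap h3 (fun x y => (gibbsState β H₀ (gammaOne x * gammaOne y)).re)]
    change ∑ x, ∑ μ, (pairCorr β H₀ x (shift x μ) + pairCorr β H₀ (shift x μ) x) = _
    simp_rw [hsymm, ← two_mul]
    rw [Finset.sum_comm, Finset.mul_sum]
    refine Finset.sum_congr rfl fun i _ => ?_
    rw [Finset.mul_sum]
  have h22 := sum_adj_re_gibbsState_gammaTwo_mul (d := d) h3 β κ U g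
  rw [← hH₀] at h22
  -- expand `H₀` (real coefficients)
  have hcardC : (Fintype.card (FermionTorus (d + 1) L) : ℂ) = ((L : ℝ) : ℂ) ^ (d + 1) := by
    rw [show Fintype.card (FermionTorus (d + 1) L) = L ^ (d + 1) by
      simp only [FermionTorus, Fintype.card_lex, Fintype.card_fun, Fintype.card_fin]]
    push_cast; ring
  have hexp : H₀ = peierlsHubbard (G d L) (piFluxAmpl κ) 0 +
      ((U / 2 + g * (d + 1) : ℝ) : ℂ) • ∑ x : FermionTorus (d + 1) L, gammaOne x * gammaOne x -
      ((U * (L : ℝ) ^ (d + 1) / 4 : ℝ) : ℂ) • (1 : Matrix _ _ ℂ) -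
      ((g / 4 : ℝ) : ℂ) • ∑ x : FermionTorus (d + 1) L, ∑ y : FermionTorus (d + 1) L,
        (if (G d L).Adj x y then gammaOne x * gammaOne y + gammaTwo x * gammaTwo y else 0) := by
    rw [hH₀]
    unfold hamiltonian PairHopRP.hamiltonian
    rw [peierlsHubbard_eq_add_U (G d L) (piFluxAmpl κ) U, sum_hubbardU_eq, pairInteraction_zero_eq h3, Complex.ofReal_zero,
      zero_smul, sub_zero, hcardC]
    push_cast
    module
  have hobs : gibbsState β H₀ H₀ = gibbsState β H₀ (peierlsHubbard (G d L) (piFluxAmpl κ) 0 +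
      ((U / 2 + g * (d + 1) : ℝ) : ℂ) • ∑ x : FermionTorus (d + 1) L, gammaOne x * gammaOne x -
      ((U * (L : ℝ) ^ (d + 1) / 4 : ℝ) : ℂ) • (1 : Matrix _ _ ℂ) -
      ((g / 4 : ℝ) : ℂ) • ∑ x : FermionTorus (d + 1) L, ∑ y : FermionTorus (d + 1) L,
        (if (G d L).Adj x y then gammaOne x * gammaOne y + gammaTwo x * gammaTwo y else 0)) := by
    rw [← hexp]
  -- the two expectation sums
  have hP : (gibbsState β H₀ (∑ x : FermionTorus (d + 1) L, gammaOne x * gammaOne x)).re =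
      ∑ x : FermionTorus (d + 1) L, (gibbsState β H₀ (gammaOne x * gammaOne x)).re := by
    rw [map_sum, Complex.re_sum]
  have hpair : (gibbsState β H₀ (∑ x : FermionTorus (d + 1) L, ∑ y : FermionTorus (d + 1) L,
      (if (G d L).Adj x y then gammaOne x * gammaOne y + gammaTwo x * gammaTwo y else 0))).re =
      4 * ∑ i : Fin (d + 1), ∑ x : FermionTorus (d + 1) L, pairCorr β H₀ x (shift x i) := by
    have h : ∀ x : FermionTorus (d + 1) L, (gibbsState β H₀ (∑ y : FermionTorus (d + 1) L,
        (if (G d L).Adj x y then gammaOne x * gammaOne y + gammaTwo x * gammaTwo y else 0))).re =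
        ∑ y : FermionTorus (d + 1) L, ((if (G d L).Adj x y then (gibbsState β H₀ (gammaOne x * gammaOne y)).re else 0) +
          (if (G d L).Adj x y then (gibbsState β H₀ (gammaTwo x * gammaTwo y)).re else 0)) := by
      intro x
      rw [map_sum, Complex.re_sum]
      refine Finset.sum_congr rfl fun y _ => ?_
      split_ifs
      · rw [map_add, Complex.add_re]
      · rw [map_zero, Complex.zero_re, add_zero]
    rw [map_sum, Complex.re_sum]
    simp_rw [h, Finset.sum_add_distrib]
    rw [h11, h22]
    ring
  rw [hobs, map_sub, map_sub, map_add, map_smul, map_smul, map_smul, smul_eq_mul, smul_eq_mul, smul_eq_mul,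
    gibbsState_one β H₀ hZ, mul_one, Complex.sub_re, Complex.sub_re, Complex.add_re, Complex.re_ofReal_mul,
    Complex.re_ofReal_mul, Complex.ofReal_re, hP, hpair]
  ring

/-! ### (B.2): the hopping energy -/

/-- **(B.2)**: `Re⟨K(T_π)⟩_β ≥ -4(d+1)κ|Λ|` in any Gibbs state (from `Σ_x[Γ¹_x,[K,Γ¹_x]] = -2K` and the
bound `8(d+1)κ|Λ|` of `KomaPiFluxHoppingDoubleCommutator`). [cite: Koma2022, App. B (B.2)] -/
theorem re_gibbsState_hopping_ge (h3 : 3 ≤ L) {κ : ℝ} (hκ : 0 ≤ κ) (β : ℝ)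
    {H : Matrix (Finset (Orb (FermionTorus (d + 1) L))) (Finset (Orb (FermionTorus (d + 1) L))) ℂ} (hH : H.IsHermitian) :
    -(4 * (d + 1) * κ * (L : ℝ) ^ (d + 1)) ≤ (gibbsState β H (peierlsHubbard (G d L) (piFluxAmpl κ) 0)).re := by
  have h := sum_re_gibbsState_doubleComm_hopping_le (d := d) h3 hκ β hH
  rw [← Complex.re_sum, ← map_sum, sum_gammaOne_doubleComm_hopping, map_smul, smul_eq_mul, neg_mul, Complex.neg_re,
    show (2 : ℂ) = ((2 : ℝ) : ℂ) by norm_num, Complex.re_ofReal_mul] at h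
  linarith

/-! ### (B.7)–(B.10): the thermal energy is below `E₀ + |Λ| log 4/β` -/

omit [NeZero L] in
/-- The Fock space of `|Λ|` sites has dimension `4^{|Λ|}`: `log dim = |Λ| log 4`. [folklore] -/
private theorem log_card_fock :
    Real.log (Fintype.card (Finset (Orb (FermionTorus (d + 1) L)))) = (L : ℝ) ^ (d + 1) * Real.log 4 := by
  rw [Fintype.card_finset, Fintype.card_lex, Fintype.card_prod, Fintype.card_fin,
    show Fintype.card (FermionTorus (d + 1) L) = L ^ (d + 1) by
      simp only [FermionTorus, Fintype.card_lex, Fintype.card_fun, Fintype.card_fin],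
    Nat.cast_pow, Real.log_pow, show (4 : ℝ) = 2 ^ 2 by norm_num, Real.log_pow]
  push_cast
  ring

omit [NeZero L] in
/-- **(B.7)–(B.10), finite volume**: `Re⟨H⟩_β ≤ E₀(H) + |Λ| log 4/β` for `β > 0` (free energy below the
ground energy, entropy at most `log dim`). [cite: Koma2022, App. B (B.7)–(B.10)] [cite: Ruelle1969, §2.5–2.6] -/
theorem re_gibbsState_self_le_groundEnergy_add {β : ℝ} (hβ : 0 < β)
    {H : Matrix (Finset (Orb (FermionTorus (d + 1) L))) (Finset (Orb (FermionTorus (d + 1) L))) ℂ} (hH : H.IsHermitian) :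
    (gibbsState β H H).re ≤ H.groundEnergy + (L : ℝ) ^ (d + 1) * Real.log 4 / β := by
  have h1 := hH.mul_energy_le_log_card_sub_log_partitionFn β
  have h2 := hH.neg_log_partitionFn_le_mul_groundEnergy β
  rw [log_card_fock] at h1
  have hid : β * ((L : ℝ) ^ (d + 1) * Real.log 4 / β) = (L : ℝ) ^ (d + 1) * Real.log 4 := by field_simp
  have h3 : β * (gibbsState β H H).re ≤ β * (H.groundEnergy + (L : ℝ) ^ (d + 1) * Real.log 4 / β) := by
    rw [mul_add, hid]; linarith
  exact le_of_mul_le_mul_left h3 hβ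

/-! ### (B.3) + (B.11): the lower bound on `N₁` -/

/-- **(B.3)+(B.11), finite volume**: for `H₀ = H(κ,U,g,0,0)` (`κ ≥ 0`, `β > 0`, `L ≥ 3`),
`g N₁ ≥ -E₀(H₀) - |Λ| log 4/β - 4(d+1)κ|Λ| - U|Λ|/4 - {-(U/2 + g(d+1))}₊ |Λ|`
(`N₁ = Σ_iΣ_x Re⟨Γ¹_xΓ¹_{x+e_i}⟩`; with the variational bound `E₀(H₀) ≤ U|Λ|/4 + g(d+1)|Λ|/2` this is
Koma's `E₁ ≥ ½ - δ̃(β)/(dg) - |κ|/g` at `U = -2(d+1)g`). [cite: Koma2022, (6.36), App. B (B.3), (B.11)] -/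
theorem nearestNeighbour_lower_bound (h3 : 3 ≤ L) {β : ℝ} (hβ : 0 < β) {κ : ℝ} (hκ : 0 ≤ κ) (U g : ℝ) :
    -(hamiltonian κ U g (fun (_ _ : FermionTorus (d + 1) L) => (0 : ℝ)) 0).groundEnergy -
        (L : ℝ) ^ (d + 1) * Real.log 4 / β - 4 * (d + 1) * κ * (L : ℝ) ^ (d + 1) - U * (L : ℝ) ^ (d + 1) / 4 -
        max (-(U / 2 + g * (d + 1))) 0 * (L : ℝ) ^ (d + 1) ≤
      g * ∑ i : Fin (d + 1), ∑ x : FermionTorus (d + 1) L,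
        pairCorr β (hamiltonian κ U g (fun (_ _ : FermionTorus (d + 1) L) => (0 : ℝ)) 0) x (shift x i) := by
  set H₀ := hamiltonian κ U g (fun (_ _ : FermionTorus (d + 1) L) => (0 : ℝ)) 0 with hH₀
  have hH : H₀.IsHermitian := hamiltonian_isHermitian (G d L) (piFluxAmpl κ) (piFluxAmpl_herm κ) U g _ 0
  have hE := re_gibbsState_hamiltonian_eq (d := d) h3 β κ U g
  rw [← hH₀] at hE
  have hK := re_gibbsState_hopping_ge (d := d) h3 hκ β hH
  have hT := re_gibbsState_self_le_groundEnergy_add (d := d) hβ hH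
  -- `0 ≤ Σ Re⟨P_x⟩ ≤ |Λ|`
  have hP0 : 0 ≤ ∑ x : FermionTorus (d + 1) L, (gibbsState β H₀ (gammaOne x * gammaOne x)).re :=
    Finset.sum_nonneg fun x _ => by
      rw [gammaOne_sq_eq_gammaTwo_sq]
      have hA : (gammaTwo x * gammaTwo x).PosSemidef := by
        nth_rw 1 [← (gammaTwo_isHermitian x).eq]
        exact Matrix.posSemidef_conjTranspose_mul_self _
      exact (Complex.nonneg_iff.mp (gibbsState_nonneg_of_posSemidef β hH hA)).1
  have hP1 : ∑ x : FermionTorus (d + 1) L, (gibbsState β H₀ (gammaOne x * gammaOne x)).re ≤ (L : ℝ) ^ (d + 1) := by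
    calc ∑ x : FermionTorus (d + 1) L, (gibbsState β H₀ (gammaOne x * gammaOne x)).re
        ≤ ∑ _x : FermionTorus (d + 1) L, (1 : ℝ) := Finset.sum_le_sum fun x _ => by
          rw [gammaOne_sq_eq_gammaTwo_sq]; exact re_gibbsState_gammaTwo_sq_le_one β hH x
      _ = (L : ℝ) ^ (d + 1) := by
          rw [Finset.sum_const, Finset.card_univ, nsmul_eq_mul, mul_one,
            show Fintype.card (FermionTorus (d + 1) L) = L ^ (d + 1) by
              simp only [FermionTorus, Fintype.card_lex, Fintype.card_fun, Fintype.card_fin], Nat.cast_pow]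
  -- `(U/2 + gD) Σ⟨P⟩ ≥ -{-(U/2+gD)}₊ |Λ|`
  have hcoef : -(max (-(U / 2 + g * (d + 1))) 0 * (L : ℝ) ^ (d + 1)) ≤
      (U / 2 + g * (d + 1)) * ∑ x : FermionTorus (d + 1) L, (gibbsState β H₀ (gammaOne x * gammaOne x)).re := by
    rcases le_or_gt 0 (U / 2 + g * (d + 1)) with hc | hc
    · rw [max_eq_right (by linarith), zero_mul, neg_zero]
      exact mul_nonneg hc hP0
    · rw [max_eq_left (by linarith)]
      nlinarith
  linarith

end KomaPiFlux

end Literature.MathematicalPhysics.QuantumLattice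

end
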